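import Summits.CriticalPhenomena.PercolationContinuityZ3.Theorems.Transplant.SkelPhiCellsSmallMV
import Summits.CriticalPhenomena.PercolationContinuityZ3.Theorems.Transplant.SkelConcRealisedO
import Summits.CriticalPhenomena.PercolationContinuityZ3.Theorems.Transplant.KNCells2SchemeO
import Summits.CriticalPhenomena.PercolationContinuityZ3.Theorems.Transplant.KNCellsSchemeO
import Summits.CriticalPhenomena.PercolationContinuityZ3.Theorems.Transplant.PlanarCells2VDefs
import HarnessLib

/-!
# N2 (frames-only node `SamePDropOfSkeletonFrm₁`, OPEN) — J23/(R-45) V layer: **THE REALISED-ANCHOR FACTS AT THE TWIN SCHEME `cellGeomSG₂bV`**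
# (`Skelφ.cellGeomSG₂bV_anchor'`, `cellGeomSG₂bV_a₀'`, `realised_of_choice_SG₂bV`, `tgt_add_stepVec_ne_zero₂bV`, `l1_tgt_le_nQ₂bV`; hp-8 g44;
# split out of `SkelPhiFaceRunNbV` §1 VERBATIM, original names, on p5-g17's ask 2026-08-23T18:05:23Z / lead ruling 19:18:26Z (1) so that the (C)
# column's `SkelPhiReachRadiiQV` / `SkelPhiNegReachDeepOV` can land over `SkelPhiCellsSmallMV` without the V3 face chain; `SkelPhiFaceRunNbV` imports this file)

Five one-line facts about the twin scheme record `cellGeomSG₂bV` (SkelPhiCellsSmallMV): its re-centring rule is the lag-1 rule and its root anchor is `0`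
(both `rfl`), hence the anchors of a chosen edge are realised (`Skel.realised_of_choiceO`), onward targets are never the root cell (root footprint
`ψ t = 0`), and the norm of a chosen target is below its cube count (`Skel.l1_tgt_le_nQO`). The V twins of N1's `SkelPhiFaceRunNb` §1.
builds on p205010 (kernel theorem, internal audit signed; external expert review pending) — nothing here uses p205010; NOTHING is claimed about the
open node `SamePDropOfSkeletonFrm₁`.
Lane `prim-bschramm`, seat `prim-hp-8` (gen 44); helper file (`--supports stmt-CriticalPhenomena-4575 --as helper`).
[cite: KozmaNitzan2024, §4 p. 27 ((29)–(30)), Lemma 10 (p. 17)] [cite: MartineauSevero2019, Cor. 2.2]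
-/

noncomputable section

open scoped Classical

namespace Summit.CriticalPhenomena.PercolationContinuityZ3.Theorems.Transplant

namespace Skelφ

open Literature.Probability.Percolation Literature.Probability.LatticeModels SimpleGraph KNCells KNLevels GadgetSystem Contour
open Literature.Probability.Percolation.KozmaNitzan
open Literature.Probability.Percolation.KozmaNitzan.Cells (oth oth_ne sgOf sgOf_sign stepVec_apply_fst stepVec_apply_oth eq_oth_of_ne oth_oth)
open BoxProdZ2 (ConcRadiiG Erad Frad nQ nS Realised Frad_succ Frad_le_Erad)

variable {V : Type} [DecidableEq V] {G : SimpleGraph V} [G.LocallyFinite]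

/-! ## §1 The realised-anchor facts at the twin scheme -/

section SG

variable (G) (ψ : V → Site 2) (P : PCells2V) (t : V) (Λ : ConcRadiiG) (b₀ : Fin 2 → ℕ) (q : unitInterval) (δc : ℝ)

/-- The re-centring rule of the twin is the lag-1 rule. [folklore] -/
theorem cellGeomSG₂bV_anchor' : ∀ a v Q, (⟨cellGeomSG₂bV G ψ P t Λ b₀, q, δc⟩ : KSchA V ℕ).Γ.anchor a v Q = a + 1 := fun _ _ _ => rfl

/-- The root anchor of the twin is `0`. [folklore] -/
theorem cellGeomSG₂bV_a₀' : (⟨cellGeomSG₂bV G ψ P t Λ b₀, q, δc⟩ : KSchA V ℕ).Γ.a₀ = 0 := rfl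

variable {G ψ P t Λ b₀ q δc}

/-- **The anchors of a chosen edge of the twin scheme are realised.** [folklore] -/
theorem realised_of_choice_SG₂bV [Countable V] (h : ProbeHistory V) {e : Site 2 × MDir}
    (hc : ((⟨cellGeomSG₂bV G ψ P t Λ b₀, q, δc⟩ : KSchA V ℕ).astOf₂O G h).st.ochoice KSchA.qNE = some e) :
    Realised ((⟨cellGeomSG₂bV G ψ P t Λ b₀, q, δc⟩ : KSchA V ℕ).aOf₁O G h e) ((⟨cellGeomSG₂bV G ψ P t Λ b₀, q, δc⟩ : KSchA V ℕ).aOf₂O G h e)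
      (tgt e) :=
  Skel.realised_of_choiceO (cellGeomSG₂bV_anchor' G ψ P t Λ b₀ q δc) (cellGeomSG₂bV_a₀' G ψ P t Λ b₀ q δc) h hc

/-- **Onward targets are never the root cell** (twin scheme; root footprint `ψ t = 0`). [cite: KozmaNitzan2024, §4 p. 27 ((29))] -/
theorem tgt_add_stepVec_ne_zero₂bV [Countable V] (hψ : ψ t = 0) {h : ProbeHistory V} {e : Site 2 × MDir}
    (hV : (⟨cellGeomSG₂bV G ψ P t Λ b₀, q, δc⟩ : KSchA V ℕ).Valid₂O G h e) {du : MDir}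
    (hdu : du ∈ (⟨cellGeomSG₂bV G ψ P t Λ b₀, q, δc⟩ : KSchA V ℕ).onwardO G h (tgt e)) : tgt e + stepVec du ≠ 0 := by
  intro h0
  have hroot := hV.root_mem
  have hon := (Finset.mem_filter.1 (Finset.mem_filter.1 hdu).1).2 _ hroot
  apply hon
  show ψ t = P.cenS (tgt e + stepVec du)
  rw [h0, PCells2T.cenS_zero, hψ]

/-- The norm of a chosen target is below its cube count (twin scheme). [folklore] -/
theorem l1_tgt_le_nQ₂bV [Countable V] (h : ProbeHistory V) {e : Site 2 × MDir}
    (hc : ((⟨cellGeomSG₂bV G ψ P t Λ b₀, q, δc⟩ : KSchA V ℕ).astOf₂O G h).st.ochoice KSchA.qNE = some e) :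
    ((tgt e) 0).natAbs + ((tgt e) 1).natAbs ≤ nQ ((⟨cellGeomSG₂bV G ψ P t Λ b₀, q, δc⟩ : KSchA V ℕ).aOf₁O G h e) (tgt e) :=
  Skel.l1_tgt_le_nQO (cellGeomSG₂bV_anchor' G ψ P t Λ b₀ q δc) (cellGeomSG₂bV_a₀' G ψ P t Λ b₀ q δc) h hc

end SG

end Skelφ

end Summit.CriticalPhenomena.PercolationContinuityZ3.Theorems.Transplant

end
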